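import Literature.Analysis.FluidPDE.LongTimeAveragePeriodic
import Literature.Analysis.FunctionSpaces.TorusTimePeriodization
import Literature.Analysis.FunctionSpaces.TorusClassicalNSRestart
import Summits.AnomalousDissipation.AnomalousDissipation.Theorems.BaireTransferDenseLoudDesignerForcesStubTrajectoryPowerBudget

/-!
# Stub 5 `stub_classicalPeriodicWitness` of the line `ergodic-budget-selection-closing`
# (crux `BaireTransfer.DenseLoudDesignerForces`, stmt-AnomalousDissipation-1143)

Sorry-free discharge of the registered stub `stub_classicalPeriodicWitness` of the lead's skeleton
(`Cruxes/DenseLoudDesignerForces/Lines/ergodic-budget-selection-closing.lean`) over the landed line vocabulary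
`Theorems/BaireTransferDenseLoudDesignerForcesErgodicLine.lean` (namespace `…Theorems.DenseLoudDesignerForces.Ergodic`:
`Hsp`, `rep`, `enstrophyObs`, `energyAvg`, `dissipAvg`, `IsNSPhase`).

**Statement (a periodic point of the semiflow is a classical time-periodic witness).**  Let `(K, φ)` be an NS
phase for the steady designer force `f_c = force S c` at viscosity `ν`, and let `z ∈ K` be a periodic point of
the semiflow, `φ_T z = z` with `T > 0`.  Then there is a classical solution `(u, p)` of NS_ν(f_c) on ALL of
`ℝ × T³`, `T`-periodic in time, whose long-time mean energy and mean dissipation (the `limsup` functionals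
`meanEnergy`, `meanDissipation` of `Literature/Analysis/FluidPDE/ZerothLaw.lean`) are the trajectory time means
`energyAvg φ z T`, `dissipAvg ν φ z T` over one period.

**Proof.**  (i) The trajectory of `z` (`IsNSPhase.trajectory`) is a classical solution `(u₀, p₀)` on
`[0, ∞) × T³` with `u₀(t)` representing `φ_t z`.  (ii) `φ_{t+T} z = φ_t (φ_T z) = φ_t z`, so `u₀(t + T)` and
`u₀(t)` are a.e. equal smooth fields, hence equal (`t ≥ 0`; Haar measure charges open sets).  (iii) Normalise
the pressure at the base point `0 ∈ T³` (`Torus.IsClassicalNSSolutionOn.sub_pressure_apply`); the normalised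
pressure `p̃₀` is then `T`-periodic on `(0, ∞)` as well, because the velocity determines the pressure up to a
function of time (`Torus.IsClassicalNSSolutionOn.pressure_sub_eq_of_eventuallyEq`, applied to the solution and
its time translate — classical solutions with a steady force are translation invariant in time,
`stub_classicalPeriodicWitness_aux_translate`).  (iv) Periodise from the window `[T, 2T)`
(not `[0, T)`: at the seams only values at times `≥ T > 0` are compared, where (iii) is available):
`u := timePeriodize T T u₀`, `p := timePeriodize T T p̃₀` (`TorusTimePeriodization`).  Near every time `t₀`
the pair `(u, p)` is ONE time translate of `(u₀, p̃₀)|_(0,∞)` (`stub_classicalPeriodicWitness_aux_eventually_eq`: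
on both sides of a seam the two descriptions of the wrap differ by exactly one period, absorbed by (ii)–(iii)),
so `(u, p)` is a classical solution on `univ` by locality in time (`Torus.IsClassicalNSSolutionOn.of_local`).
(v) For `T`-periodic fields the `limsup` means are period means (`meanEnergy_eq_of_periodic`,
`meanDissipation_eq_of_periodic`, Cheskidov 2023 §6); on `[0, T]` one has `u = u₀`, `‖φ_t z‖² = ∫‖u₀(t)‖²`
(`stub_trajectoryPowerBudget_aux_norm_sq`) and `enstrophyObs (φ_t z) = ‖∇u₀(t)‖₂²` (the spectral enstrophy
only sees the a.e.-class, `eGradNormSq_congr_ae`).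

References: A. Cheskidov, *Dissipation anomaly and anomalous dissipation in incompressible fluid flows*,
arXiv:2311.04182 (2023), §6 (period means of time-periodic solutions); J. C. Robinson, J. L. Rodrigo,
W. Sadowski, *The Three-Dimensional Navier–Stokes Equations* (CUP 2016), §6.3, §8.1 (restart, identification on
overlaps); Foias–Manley–Rosa–Temam, *Navier–Stokes Equations and Turbulence* (CUP 2001) Ch. IV §2.
-/

set_option linter.dupNamespace false

noncomputable section

open scoped BigOperators Topology ENNReal InnerProductSpace
open Filter Set Function MeasureTheory

namespace Summit.AnomalousDissipation.AnomalousDissipation.Theorems.DenseLoudDesignerForces.Ergodic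

open Literature.Analysis.FunctionSpaces Literature.Analysis.FunctionSpaces.Torus
open Literature.Analysis.FluidPDE Literature.Analysis.FluidPDE.Torus
open Summit.AnomalousDissipation.AnomalousDissipation.Theses.BaireTransfer
open Summit.AnomalousDissipation.AnomalousDissipation.Theorems.DenseLoudDesignerForces.Negative

/-! ## Time translation of classical solutions with a steady force, local form of the periodisation -/

section ClassicalPeriodicWitness

/-- **Time-translation invariance of classical solutions with a steady force.**  If `(u, p)` is a classical
solution of NS_ν forced by the steady `F` on the open half-line `(0, ∞)`, then `t ↦ (u (t - a), p (t - a))` is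
a classical solution on `(a, ∞)`: joint smoothness is composed with the affine map `(t, y) ↦ (t - a, y)`, and on
open time sets the time derivatives are two-sided, hence translation invariant (Mathlib `deriv_comp_sub_const`).
[folklore] -/
theorem stub_classicalPeriodicWitness_aux_translate {ν : ℝ}
    {F : (UnitAddTorus (Fin 3)) → (EuclideanSpace ℝ (Fin 3))}
    {u : ℝ → (UnitAddTorus (Fin 3)) → (EuclideanSpace ℝ (Fin 3))} {p : ℝ → (UnitAddTorus (Fin 3)) → ℝ}
    (h : IsClassicalNSSolutionOn (Ioi 0) ν (fun _ => F) u p) (a : ℝ) :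
    IsClassicalNSSolutionOn (Ioi a) ν (fun _ => F) (fun t => u (t - a)) (fun t => p (t - a)) where
  smooth_velocity :=
    h.smooth_velocity.comp ((contDiff_fst.sub contDiff_const).prodMk contDiff_snd).contDiffOn
      fun q hq => ⟨mem_Ioi.2 (sub_pos.2 (mem_Ioi.1 (mem_prod.1 hq).1)), mem_univ _⟩
  smooth_pressure :=
    h.smooth_pressure.comp ((contDiff_fst.sub contDiff_const).prodMk contDiff_snd).contDiffOn
      fun q hq => ⟨mem_Ioi.2 (sub_pos.2 (mem_Ioi.1 (mem_prod.1 hq).1)), mem_univ _⟩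
  momentum t ht x := by
    have hta : t - a ∈ Ioi (0 : ℝ) := mem_Ioi.2 (sub_pos.2 (mem_Ioi.1 ht))
    have hD : Torus.timeDerivWithin (Ioi a) (fun s => u (s - a)) t x =
        Torus.timeDerivWithin (Ioi 0) u (t - a) x := by
      show derivWithin (fun s => u (s - a) x) (Ioi a) t = derivWithin (fun s => u s x) (Ioi 0) (t - a)
      rw [derivWithin_of_mem_nhds (Ioi_mem_nhds (mem_Ioi.1 ht)),
        derivWithin_of_mem_nhds (Ioi_mem_nhds (mem_Ioi.1 hta))]
      exact deriv_comp_sub_const (fun s => u s x) a t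
    rw [hD]
    exact h.momentum (t - a) hta x
  divFree t ht := h.divFree (t - a) (mem_Ioi.2 (sub_pos.2 (mem_Ioi.1 ht)))

/-- **Local form of the periodisation from the window `[T, 2T)`.**  If `w (s + T) = w s` for all `s > 0`, then
near every time `t₀` the periodisation `timePeriodize T T w` is the single time translate
`t ↦ w (t - (n - 1) T)`, `n = ⌊(t₀ - T)/T⌋`, and `(n - 1) T < t₀` (indeed `t₀ - (n - 1) T ≥ 2T`): away from a
seam the wrap is `t - n T ≥ T`, one period above `t - (n - 1) T`'s description, and the hypothesis absorbs the
period; to the left of a seam the wrap IS `t - (n - 1) T` (`timeWrap_eventually_eq_or`). [folklore] -/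
theorem stub_classicalPeriodicWitness_aux_eventually_eq {X : Type*} {T : ℝ} (hT : 0 < T) {w : ℝ → X}
    (hw : ∀ s : ℝ, 0 < s → w (s + T) = w s) (t₀ : ℝ) :
    ((⌊(t₀ - T) / T⌋ - 1 : ℤ) : ℝ) * T < t₀ ∧
      ∀ᶠ t in 𝓝 t₀, timePeriodize T T w t = w (t - ((⌊(t₀ - T) / T⌋ - 1 : ℤ) : ℝ) * T) := by
  have key := timeWrap_eventually_eq_or (a := T) hT t₀ hT
  have hmem₀ := timeWrap_mem_Ico (a := T) hT t₀
  have h0 : timeWrap T T t₀ = t₀ - ⌊(t₀ - T) / T⌋ * T := rfl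
  rw [h0] at hmem₀
  generalize ⌊(t₀ - T) / T⌋ = n at key hmem₀ ⊢
  have e1 : ((n - 1 : ℤ) : ℝ) * T = n * T - T := by push_cast; ring
  refine ⟨?_, ?_⟩
  · rw [e1]
    linarith [hmem₀.1]
  · filter_upwards [key] with t ht
    rw [timePeriodize_apply]
    rcases ht with h | ⟨h, -, -⟩
    · rw [h]
      have hmem := timeWrap_mem_Ico (a := T) hT t
      rw [h] at hmem
      have e : t - ((n - 1 : ℤ) : ℝ) * T = (t - n * T) + T := by push_cast; ring
      rw [e, hw _ (by linarith [hmem.1])]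
    · rw [h]

/-- **Stub 5 of the line `ergodic-budget-selection-closing`: a periodic point of the NS_ν(f_c) semiflow on an
NS phase is a classical time-periodic witness.**  If `φ_T z = z` with `T > 0` for some `z ∈ K`, then there is a
classical solution `(u, p)` of NS_ν forced by `f_c` on all of `ℝ × T³`, `T`-periodic in time, whose `limsup`
mean energy and mean dissipation are the trajectory period means `energyAvg φ z T` and `dissipAvg ν φ z T`
(periodicity of the trajectory from a.e.-equality of smooth slices, pressure normalisation, periodisation in
time and locality of classical solutions, period means of periodic functions). [cite: Cheskidov2023, §6 (period means of time-periodic solutions)] -/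
theorem stub_classicalPeriodicWitness {S : Finset (Fin 3 → ℤ)} {c : ↥S → (EuclideanSpace ℂ (Fin 3))} {ν : ℝ} {K : Set Hsp} {φ : ℝ → Hsp → Hsp} {z : Hsp} {T : ℝ} (hν : 0 < ν) (hK : IsNSPhase ν (force S c) K φ) (hz : z ∈ K) (hT : 0 < T) (hfix : φ T z = z) : ∃ (u : ℝ → (UnitAddTorus (Fin 3)) → (EuclideanSpace ℝ (Fin 3))) (p : ℝ → (UnitAddTorus (Fin 3)) → ℝ), IsClassicalNSSolutionOn univ ν (fun _ => force S c) u p ∧ Function.Periodic u T ∧ meanEnergy u = energyAvg φ z T ∧ meanDissipation ν u = dissipAvg ν φ z T := by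
  have _hν : 0 < ν := hν
  obtain ⟨u0, p0, hsol, hrep⟩ := hK.trajectory z hz
  -- (ii) the velocity of the trajectory is `T`-periodic on `[0, ∞)`
  have hcont : ∀ t : ℝ, 0 ≤ t → Continuous (u0 t) := fun t ht =>
    (hsol.smooth_velocity.isSmooth_slice (mem_Ici.2 ht)).continuous
  have hperU : ∀ s : ℝ, 0 ≤ s → u0 (s + T) = u0 s := by
    intro s hs
    have hsT : 0 ≤ s + T := by linarith
    have h1 := hrep (s + T) hsT
    rw [hK.map_add s T hs hT.le z hz, hfix] at h1
    exact (Continuous.ae_eq_iff_eq volume (hcont _ hsT) (hcont _ hs)).1 (h1.symm.trans (hrep s hs))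
  have hperU' : ∀ s : ℝ, 0 < s → u0 (s + T) = u0 s := fun s hs => hperU s hs.le
  -- (iii) normalised pressure: a classical solution on `(0, ∞)`, `T`-periodic as well
  obtain ⟨pn, hsolI, hpn0⟩ : ∃ pn : ℝ → (UnitAddTorus (Fin 3)) → ℝ,
      IsClassicalNSSolutionOn (Ioi 0) ν (fun _ => force S c) u0 pn ∧
        ∀ t : ℝ, pn t (0 : UnitAddTorus (Fin 3)) = 0 :=
    ⟨fun t x => p0 t x - p0 t 0,
      (hsol.sub_pressure_apply 0).mono Ioi_subset_Ici_self (uniqueDiffOn_Ioi 0), fun t => sub_self _⟩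
  have hperP : ∀ s : ℝ, 0 < s → pn (s + T) = pn s := by
    intro s hs
    have h₁ := stub_classicalPeriodicWitness_aux_translate hsolI T
    have hsT : T < s + T := by linarith
    have heq : ∀ᶠ τ in 𝓝 (s + T), u0 (τ - T) = u0 τ := by
      filter_upwards [Ioi_mem_nhds hsT] with τ hτ
      have h0 : 0 ≤ τ - T := by linarith [mem_Ioi.1 hτ]
      have h := hperU (τ - T) h0
      rw [sub_add_cancel] at h
      exact h.symm
    funext x
    have key := h₁.pressure_sub_eq_of_eventuallyEq hsolI (Ioi_mem_nhds hsT) (Ioi_mem_nhds (hT.trans hsT))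
      heq x 0
    simp only [add_sub_cancel_right, hpn0, sub_zero] at key
    exact key.symm
  -- (iv) periodise from the window `[T, 2T)`
  have hper : Function.Periodic (timePeriodize T T u0) T := periodic_timePeriodize hT u0
  -- on `[0, T]` the periodisation is the trajectory itself
  have hUeq : ∀ t ∈ Icc (0 : ℝ) T, timePeriodize T T u0 t = u0 t := by
    intro t ht
    rcases eq_or_lt_of_le ht.2 with h | h
    · rw [h]
      exact timePeriodize_eq_self hT u0 ⟨le_rfl, by linarith⟩
    · have e : t - ((-1 : ℤ) : ℝ) * T = t + T := by push_cast; ring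
      have hmem : t - ((-1 : ℤ) : ℝ) * T ∈ Ico T (T + T) := by
        rw [e]
        exact ⟨by linarith [ht.1], by linarith⟩
      rw [timePeriodize_apply, (timeWrap_eq_sub_iff hT t (-1)).2 hmem, e, hperU t ht.1]
  refine ⟨timePeriodize T T u0, timePeriodize T T pn, ?_, hper, ?_, ?_⟩
  · -- classical solution on all of `ℝ`, by locality in time
    refine IsClassicalNSSolutionOn.of_local isOpen_univ fun t₀ _ => ?_
    obtain ⟨hm, hevU⟩ := stub_classicalPeriodicWitness_aux_eventually_eq hT hperU' t₀
    obtain ⟨-, hevP⟩ := stub_classicalPeriodicWitness_aux_eventually_eq hT hperP t₀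
    obtain ⟨O, hO, hOo, ht₀O⟩ := eventually_nhds_iff.1 ((hevU.and hevP).and (eventually_gt_nhds hm))
    exact ⟨O, hOo, ht₀O, subset_univ _, fun s => u0 (s - ((⌊(t₀ - T) / T⌋ - 1 : ℤ) : ℝ) * T),
      fun s => pn (s - ((⌊(t₀ - T) / T⌋ - 1 : ℤ) : ℝ) * T),
      (stub_classicalPeriodicWitness_aux_translate hsolI _).mono (fun s hs => (hO s hs).2) hOo.uniqueDiffOn,
      fun s hs => ((hO s hs).1.1).symm, fun s hs => ((hO s hs).1.2).symm⟩
  · -- mean energy = period mean of `‖φ_t z‖²`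
    rw [meanEnergy_eq_of_periodic hper hT]
    unfold energyAvg
    congr 1
    refine intervalIntegral.integral_congr fun t ht => ?_
    rw [uIcc_of_le hT.le] at ht
    rw [hUeq t ht, stub_trajectoryPowerBudget_aux_norm_sq (φ t z) (hrep t ht.1)]
  · -- mean dissipation = period mean of `ν ‖∇φ_t z‖₂²`
    rw [meanDissipation_eq_of_periodic hper hT]
    unfold dissipAvg
    congr 1
    refine intervalIntegral.integral_congr fun t ht => ?_
    rw [uIcc_of_le hT.le] at ht
    rw [hUeq t ht]
    unfold enstrophyObs
    rw [Literature.Analysis.FluidPDE.eGradNormSq_congr_ae (hrep t ht.1)]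

end ClassicalPeriodicWitness

end Summit.AnomalousDissipation.AnomalousDissipation.Theorems.DenseLoudDesignerForces.Ergodic

end
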